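import Summits.AnomalousDissipation.AnomalousDissipation.Theses.TaylorCertificates

/-!
# Crux `TaylorFloor` (stmt-AnomalousDissipation-14085; dropped from route `TaylorCertificates` at rev 6, 2026-08-16T00:46Z,
# replaced 1:1 by `KolmogorovFloor`, stmt-14030) — crux-ideate round 1, ideator 1

Idea `one-stage-beltrami-phantom` — a NEGATIVE lever, typed against the LIVE route file (rev 7): ONE Beltrami–Nash stage
realises every force as a Reynolds-stress divergence up to a Wiener-small stress at a quiet trigonometric-polynomial state;
with the landed invisible beat this kills every band-limited floor class of resolution `ν^{-β}`, `β < 3/4`, UNCONDITIONALLY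
(no forced h-principle (E∀) = route item `ForcedStandingFlows`, no packet lemma), and at `β = 3/4` (the new crux
`KolmogorovFloor`) it forces a LOWER BOUND on the Kolmogorov constant `C` of any certificate (a calibration, not a kill).

Contents (proofs are pure logic; the analytic statements are `def … : Prop`, UNPROVED, paper proofs in ONE-STAGE-PHANTOM.md):
* `FloorClassAt β f ε₀ C Θ ν₀`, `FloorClass β` — the band-limited floor class of exponent `β` (the common body of the dropped
  `TaylorFloor` = `FloorClass (1/2)` and of `KolmogorovFloor`); `kolmogorovFloor_iff : KolmogorovFloor ↔ FloorClass (3/4)` (rfl);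
* `FloorKillAt`, `not_floorClassAt_of_kill` (proved) — the `∃ν ∀cert ∃u` violation form and its logic;
* `OneStageReynoldsRealizationWiener` (qualitative, `∀η`) and `OneStageReynoldsRealizationRate` (quantitative, `A(R_λ) ≤ c/λ`) —
  the FIRST LEMMA in the two strengths the two uses need;
* `OneStageTaylorKill`, `OneStageFloorLaw`, `OneStageKolmogorovThreshold` — the three theorems of the line (stated);
* `phantomFloorLaw_of_oneStage` — PROVED: the rev-6 support item `PhantomFloorLaw` (stmt-14033) follows from the one-stage Taylor kill,
  ignoring BOTH of its premises (`ForcedStandingFlows`, `PacketLemma`); `not_floorClass_of_law` — PROVED logic for `β < 3/4`.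
-/

noncomputable section

open MeasureTheory
open scoped InnerProductSpace ENNReal BigOperators

namespace Summit.AnomalousDissipation.AnomalousDissipation.Cruxes.TaylorFloor.OneStageBeltramiPhantom

open Literature.Analysis.FunctionSpaces Literature.Analysis.FluidPDE
open Summit.AnomalousDissipation.AnomalousDissipation.Theses.TaylorCertificates

local notation "𝕋³" => UnitAddTorus (Fin 3)
local notation "E³" => EuclideanSpace ℝ (Fin 3)
local notation "L2T" => Lp (EuclideanSpace ℝ (Fin 3)) 2 (volume : Measure (UnitAddTorus (Fin 3)))

/-! ### The band-limited floor classes -/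

/-- The floor certificate family of resolution exponent `β` for a given force and constants: for every `ν ∈ (0, ν₀)` some
band-limited (`deg ≤ N ≤ C ν^{-β}`) cylindrical `Φ₁` and weight `θ₁ ∈ [−Θ, 0]` certify
`ε₀ ≤ ν‖∇u‖² + ⟨F(u), Φ₁'(u)⟩ + 2θ₁((u,f) − ν‖∇u‖²)` at every finite-enstrophy `u ∈ H` of the Leray ball. Verbatim the inner
body of the route's `KolmogorovFloor` (`β = 3/4`) and of the dropped `TaylorFloor` (`β = 1/2`). -/
def FloorClassAt (β : ℝ) (f : 𝕋³ → E³) (ε₀ C Θ ν₀ : ℝ) : Prop :=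
  ∀ ν : ℝ, 0 < ν → ν < ν₀ →
    ∃ (N : ℕ) (Φ₁ : Torus.CylindricalTest (Fin 3)) (θ₁ : ℝ), (N : ℝ) ≤ C * ν ^ (-β) ∧
    (∀ i, Torus.fourierTruncate N (Φ₁.g i) = Φ₁.g i) ∧ -Θ ≤ θ₁ ∧ θ₁ ≤ 0 ∧
    ∀ u : Torus.energySpace (Fin 3),
      let uf : 𝕋³ → E³ := ((u : L2T) : 𝕋³ → E³);
      let D : ℝ := ν * (Torus.eGradNormSq uf).toReal;
      let P : ℝ := Torus.pairing (u : L2T) f - D;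
      Torus.eGradNormSq uf ≠ ⊤ → ‖u‖ ^ 2 ≤ 16 * (∫ x, ‖f x‖ ^ 2) / ν ^ 2 →
      ε₀ ≤ D + Torus.nsGeneratorPairing ν f u (Φ₁.grad u) + 2 * θ₁ * P

/-- The band-limited floor class of exponent `β`: SOME admissible force and constants with `FloorClassAt β`. -/
def FloorClass (β : ℝ) : Prop :=
  ∃ f : 𝕋³ → E³, Torus.IsSmooth f ∧ Torus.IsDivFree f ∧ Torus.HasZeroMean f ∧
    ∃ (ε₀ C Θ ν₀ : ℝ), 0 < ε₀ ∧ 0 < ν₀ ∧ FloorClassAt β f ε₀ C Θ ν₀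

/-- Read-back check against the LIVE route decl: the rev-6 crux `KolmogorovFloor` is the class `β = 3/4`. -/
theorem kolmogorovFloor_iff : KolmogorovFloor ↔ FloorClass (3 / 4) := Iff.rfl

/-- The dropped crux `TaylorFloor` (stmt-14085), verbatim, is the class `β = 1/2`; this is also, verbatim, the statement
negated in the conclusion of the route's support item `PhantomFloorLaw` (stmt-14033). -/
def TaylorFloor : Prop := FloorClass (1 / 2)

/-- The `∃ν ∀certificate ∃u` violation form of `¬ FloorClassAt β f ε₀ C Θ ν₀`. -/
def FloorKillAt (β : ℝ) (f : 𝕋³ → E³) (ε₀ C Θ ν₀ : ℝ) : Prop :=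
  ∃ ν : ℝ, 0 < ν ∧ ν < ν₀ ∧
    ∀ (N : ℕ) (Φ₁ : Torus.CylindricalTest (Fin 3)) (θ₁ : ℝ), (N : ℝ) ≤ C * ν ^ (-β) →
    (∀ i, Torus.fourierTruncate N (Φ₁.g i) = Φ₁.g i) → -Θ ≤ θ₁ → θ₁ ≤ 0 →
    ∃ u : Torus.energySpace (Fin 3),
      let uf : 𝕋³ → E³ := ((u : L2T) : 𝕋³ → E³);
      let D : ℝ := ν * (Torus.eGradNormSq uf).toReal;
      let P : ℝ := Torus.pairing (u : L2T) f - D;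
      Torus.eGradNormSq uf ≠ ⊤ ∧ ‖u‖ ^ 2 ≤ 16 * (∫ x, ‖f x‖ ^ 2) / ν ^ 2 ∧
      D + Torus.nsGeneratorPairing ν f u (Φ₁.grad u) + 2 * θ₁ * P < ε₀

/-- Logic: a kill refutes the class at that force and constants. -/
theorem not_floorClassAt_of_kill {β : ℝ} {f : 𝕋³ → E³} {ε₀ C Θ ν₀ : ℝ}
    (hK : FloorKillAt β f ε₀ C Θ ν₀) : ¬ FloorClassAt β f ε₀ C Θ ν₀ := by
  intro h
  obtain ⟨ν, hν, hνν₀, hkill⟩ := hK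
  obtain ⟨N, Φ₁, θ₁, hN, hΦ₁, hθ₁, hθ₁', hu⟩ := h ν hν hνν₀
  obtain ⟨u, hfin, hball, hlt⟩ := hkill N Φ₁ θ₁ hN hΦ₁ hθ₁ hθ₁'
  exact absurd (hu u hfin hball) (not_le.mpr hlt)

/-! ### The lever: one-stage Reynolds realization -/

/-- **First lemma, qualitative Wiener form** (enough for `β ≤ 1/2`): for every smooth div-free mean-zero `f` and `η > 0` a smooth
div-free mean-zero trigonometric polynomial `a`, a smooth symmetric stress `R` and a smooth pressure `p` with
`(a·∇)a + ∇p = f + div R` pointwise, the Fourier-`ℓ¹` (Wiener) norm of the columns of `R` at most `η` (uniform bound on the partial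
sums over `freqBall L`; `R` is in general NOT band-limited — `div R + f` is a trigonometric polynomial, `f` need not be), and
`|(a,f)| ≤ η`. ONE Beltrami–Nash stage (ONE-STAGE-PHANTOM.md §2): `a = curl(Σ_ξ α_ξ^D B_ξ e_{λξ})/(2πλ)`, `α_ξ = ẽ^{1/2}γ_ξ(Id − R₀/ẽ)`,
`R₀ = −(∇Δ⁻¹f + (∇Δ⁻¹f)ᵀ)`, `R = E_D + ℛ(osc) + corrector stresses`; ingredients in tree: `IntermittentBeltrami.beltramiField`,
`curl_beltramiField`, `integral_mul_beltramiField`, `IntermittentBeltrami.geometric_lemma`, `BeltramiDirections.norm_sq_add_ge`,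
`Torus.antidivergence`, `tensorDivergence_antidivergence`. UNPROVED here. -/
def OneStageReynoldsRealizationWiener : Prop :=
  ∀ f : 𝕋³ → E³, Torus.IsSmooth f → Torus.IsDivFree f → Torus.HasZeroMean f →
    ∀ η : ℝ, 0 < η →
      ∃ (M : ℕ) (a : 𝕋³ → E³) (R : 𝕋³ → Fin 3 → E³) (p : 𝕋³ → ℝ),
        Torus.IsSmooth a ∧ Torus.IsDivFree a ∧ Torus.HasZeroMean a ∧ Torus.fourierTruncate M a = a ∧
        Torus.IsSmooth R ∧ (∀ x i j, R x i j = R x j i) ∧ Torus.IsSmooth p ∧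
        (∀ x, Torus.convect a a x + Torus.gradient p x = f x + Torus.tensorDivergence R x) ∧
        (∀ L : ℕ, (∑ j, ∑ k ∈ Torus.freqBall L, ‖UnitAddTorus.mFourierCoeff (EuclideanSpace.complexify ∘ fun x => R x j) k‖) ≤ η) ∧
        |∫ x, ⟪a x, f x⟫_ℝ| ≤ η

/-- **First lemma, quantitative form** (needed for `1/2 < β ≤ 3/4`, where the phantom frequency must follow `ν`): constants
`c, E₀ > 0` and `n₀` depending on `f` only such that for EVERY `n ≥ n₀` (frequency `λ = 5n`) there is a one-stage state `a` with all
Fourier modes in `{|k| ≤ 2λ}` (`fourierTruncate (10n) a = a`), energy `≤ E₀`, drift weight `Σ_k |k|‖â(k)‖ ≤ c·λ` (written as a uniform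
bound on partial sums), symmetric smooth stress with Wiener norm `≤ c/λ`, and `|(a,f)| ≤ c/λ`. Same construction with `D = D(λ) → ∞`
slowly (ONE-STAGE-PHANTOM.md §2.7). UNPROVED here. -/
def OneStageReynoldsRealizationRate : Prop :=
  ∀ f : 𝕋³ → E³, Torus.IsSmooth f → Torus.IsDivFree f → Torus.HasZeroMean f →
    ∃ (c E₀ : ℝ) (n₀ : ℕ), 0 < c ∧ 0 < E₀ ∧ ∀ n : ℕ, n₀ ≤ n → 1 ≤ n →
      ∃ (a : 𝕋³ → E³) (R : 𝕋³ → Fin 3 → E³) (p : 𝕋³ → ℝ),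
        Torus.IsSmooth a ∧ Torus.IsDivFree a ∧ Torus.HasZeroMean a ∧ Torus.fourierTruncate (10 * n) a = a ∧
        (∫ x, ‖a x‖ ^ 2) ≤ E₀ ∧
        (∀ L : ℕ, (∑ k ∈ Torus.freqBall L, ‖((k : Fin 3 → ℤ) : Fin 3 → ℤ)‖ *
            ‖UnitAddTorus.mFourierCoeff (EuclideanSpace.complexify ∘ a) k‖) ≤ c * (5 * n)) ∧
        Torus.IsSmooth R ∧ (∀ x i j, R x i j = R x j i) ∧ Torus.IsSmooth p ∧
        (∀ x, Torus.convect a a x + Torus.gradient p x = f x + Torus.tensorDivergence R x) ∧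
        (∀ L : ℕ, (∑ j, ∑ k ∈ Torus.freqBall L, ‖UnitAddTorus.mFourierCoeff (EuclideanSpace.complexify ∘ fun x => R x j) k‖)
            ≤ c / (5 * n)) ∧
        |∫ x, ⟪a x, f x⟫_ℝ| ≤ c / (5 * n)

/-! ### The three theorems of the line (stated) and their logic (proved) -/

/-- THEOREM 1 (Taylor kill; ONE-STAGE-PHANTOM.md §3): the qualitative lemma kills the class `β = 1/2` at EVERY force and constants —
fix `a` from `η(ε₀,C,Θ)`, then send `ν → 0` (beat price `(1+2Θ)ν(3N+M+2)² = O(1+C²)` stays bounded only because `νN² ≤ C²`). -/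
def OneStageTaylorKill : Prop :=
  OneStageReynoldsRealizationWiener →
    ∀ f : 𝕋³ → E³, Torus.IsSmooth f → Torus.IsDivFree f → Torus.HasZeroMean f →
      ∀ (ε₀ C Θ ν₀ : ℝ), 0 < ε₀ → 0 < ν₀ → FloorKillAt (1 / 2) f ε₀ C Θ ν₀

/-- THEOREM 2 (the one-stage floor law; ONE-STAGE-PHANTOM.md §4): with the quantitative lemma and `λ ≍ ν^{-1/2}` the same beat kills
every class `β < 3/4` (the surplus `κ·η_eff(ν)·Π(ν) = O(ν^{3/2 − 2β})` must vanish). -/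
def OneStageFloorLaw : Prop :=
  OneStageReynoldsRealizationRate →
    ∀ β : ℝ, β < 3 / 4 →
      ∀ f : 𝕋³ → E³, Torus.IsSmooth f → Torus.IsDivFree f → Torus.HasZeroMean f →
        ∀ (ε₀ C Θ ν₀ : ℝ), 0 < ε₀ → 0 < ν₀ → FloorKillAt β f ε₀ C Θ ν₀

/-- The Kolmogorov-constant threshold (calibration of the rev-6 crux `KolmogorovFloor`, stmt-14030): at `β = 3/4` the one-stage
phantom and the beat price are of the same order `ν^{-1/2}`, so every certificate family must have `C ≥ C_*(f, ε₀, Θ) > 0`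
(`C_*² ≍ ε₀^{3/2}(1+2Θ)^{-3/2} c_R(f)^{-1} E₀(f)^{-1/2}`; ONE-STAGE-PHANTOM.md §4). The analogue, one resolution up, of the dropped
`TaylorBarrier`. -/
def KolmogorovConstantThreshold : Prop :=
  ∀ f : 𝕋³ → E³, Torus.IsSmooth f → Torus.IsDivFree f → Torus.HasZeroMean f →
    ∀ (ε₀ Θ : ℝ), 0 < ε₀ → ∃ Cstar : ℝ, 0 < Cstar ∧
      ∀ C : ℝ, C < Cstar → ∀ ν₀ : ℝ, 0 < ν₀ → FloorKillAt (3 / 4) f ε₀ C Θ ν₀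

/-- THEOREM 3 (stated): the quantitative lemma gives the Kolmogorov-constant threshold. -/
def OneStageKolmogorovThreshold : Prop :=
  OneStageReynoldsRealizationRate → KolmogorovConstantThreshold

/-- Logic: Theorem 1 + lemma ⇒ the dropped crux is false. -/
theorem not_taylorFloor (h : OneStageTaylorKill) (hW : OneStageReynoldsRealizationWiener) : ¬ TaylorFloor := by
  rintro ⟨f, hfs, hfd, hfz, ε₀, C, Θ, ν₀, hε₀, hν₀, hcl⟩
  exact not_floorClassAt_of_kill (h hW f hfs hfd hfz ε₀ C Θ ν₀ hε₀ hν₀) hcl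

/-- Logic, against the LIVE route decl: the rev-6 support item `PhantomFloorLaw` (stmt-14033,
`ForcedStandingFlows → PacketLemma → ¬(TaylorFloor inlined)`) follows from Theorem 1 + the qualitative lemma, using NEITHER premise. -/
theorem phantomFloorLaw_of_oneStage (h : OneStageTaylorKill) (hW : OneStageReynoldsRealizationWiener) : PhantomFloorLaw :=
  fun _ _ => not_taylorFloor h hW

/-- Logic: Theorem 2 + quantitative lemma ⇒ no band-limited floor class below Kolmogorov resolution. -/
theorem not_floorClass_of_law (h : OneStageFloorLaw) (hR : OneStageReynoldsRealizationRate) {β : ℝ} (hβ : β < 3 / 4) :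
    ¬ FloorClass β := by
  rintro ⟨f, hfs, hfd, hfz, ε₀, C, Θ, ν₀, hε₀, hν₀, hcl⟩
  exact not_floorClassAt_of_kill (h hR β hβ f hfs hfd hfz ε₀ C Θ ν₀ hε₀ hν₀) hcl

/-- Logic: what the threshold says about witnesses of the live crux `KolmogorovFloor` — any witness `(f, ε₀, C, Θ, ν₀)` has
`C ≥ C_*(f, ε₀, Θ)`. -/
theorem kolmogorov_witness_constant_ge (hT : KolmogorovConstantThreshold) {f : 𝕋³ → E³} (hfs : Torus.IsSmooth f)
    (hfd : Torus.IsDivFree f) (hfz : Torus.HasZeroMean f) {ε₀ C Θ ν₀ : ℝ} (hε₀ : 0 < ε₀) (hν₀ : 0 < ν₀)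
    (hcl : FloorClassAt (3 / 4) f ε₀ C Θ ν₀) : ∃ Cstar : ℝ, 0 < Cstar ∧ Cstar ≤ C := by
  obtain ⟨Cstar, hpos, hkill⟩ := hT f hfs hfd hfz ε₀ Θ hε₀
  refine ⟨Cstar, hpos, ?_⟩
  by_contra hlt
  exact not_floorClassAt_of_kill (hkill C (lt_of_not_ge hlt) ν₀ hν₀) hcl

end Summit.AnomalousDissipation.AnomalousDissipation.Cruxes.TaylorFloor.OneStageBeltramiPhantom
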